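import Literature.NumberTheory.LFunctions.Zhang2022.KnifeEdgeLenZDegreeShortPolyDense
import Literature.NumberTheory.LFunctions.Zhang2022.KnifeEdgeLenZDegreeK0Piece

/-!
# Zhang (2022), rung F-S3 (Landau–Siegel programme, §D edge len = E*-len⁺): route `ZDegreeToeplitzBand` —
# the density reductions and the darkness ports RE-THREADED over the REPAIRED side tables `InClassMeanPiece` (`_piece` twins)

Y. Zhang, *Discrete mean estimates and the Landau–Siegel zero*, arXiv:2211.02515v1 [Zhang2022LandauSiegel] — an
unrefereed manuscript under adjudication. **WHAT THIS IS NOT: not a claim about Theorems 1–2 of arXiv:2211.02515, about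
Landau–Siegel zeros, or about Parity. The programme SEARCHES and TYPES; no claim about Landau–Siegel zeros, Theorems 1–2
of arXiv:2211.02515 or a repaired Margin232 until a kernel theorem says so.** `E₀`-free; NO new `Prop` is introduced; K0
and every darkness input stay hypotheses — this file ELIMINATES NOTHING.

WHY (cell landau-siegel §D, toeplitz CLOSURE SQUAD, 2026-08-27): the route's K0 item stmt-Parity-20016 `InClassSideTables`
(`∃ c₀, ∀ c′ ≥ c₀, KnifeEdge.InClassMean c′`) is MISSTATED AS TYPED — `InClassMean` quantifies over all
`Repair.KinkedProfile`s, which include the constant `u ≡ 1` (`KnifeEdge.kinkedProfile_const`, `mainTermForm_const_one`,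
`not_inClassPiece_const_one`; ls-knife-K0-p1 K0-MISSTATED.md 9d6c912d0fab6a8c, crit-1 (q)-read 14:05:18Z, theory concur,
knife-plan g1 TENURE RULING 14:08:24Z) — and is repaired by the NEW item `InClassSideTablesPiece :=
∃ c₀, ∀ c′ ≥ c₀, KnifeEdge.InClassMeanPiece c′` (binder narrowed to `InClassPiece`; `KnifeEdgeLenZDegreeK0Piece`, p535985).
`InClassMeanPiece` does NOT imply `InClassMean`, so every consumer of `hK0 : InClassMean c′` needs a `_piece` twin
(theory g5 14:14:16Z (γ) «bookkeeping consequence»; knife-plan 14:08:24Z). The density reductions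
`crossTablePsiOn_zero_of_dense` (p521442) / `dualCrossTablePsiOn_zero_of_dense` (p528742) use K0 ONLY as an UPPER bound
`Ξ(H_w) ≤ (𝔅(w) + η)𝔞𝔓` on IN-CLASS pieces `w` (`f`, `g` and the `InClassPiece.sub` differences), so this leaf:

* Part 1 — re-proves both reductions over that upper bound ALONE as an explicit hypothesis
  (`crossTablePsiOn_zero_of_dense_upper`, `dualCrossTablePsiOn_zero_of_dense_upper`; proofs = p521442 / p528742 verbatim
  with the K0 lemma replaced by the hypothesis);
* Part 2 — the `_piece` twins over the repaired K0 (`discMean_profPoly_le_of_inClassMeanPiece`, p535985):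
  `crossTablePsiOn_zero_of_dense_piece`, `dualCrossTablePsiOn_zero_of_dense_piece`, `tauTwoDarkShort_of_dense_piece[_eventually]`;
* Part 3 — the `_piece` twins of the six darkness PORTS of `KnifeEdgeLenZDegreeShortPolyDense` (p536434; density leg
  `shortPairs_dense_of_poly` PROVED there): `crossTablePsiOn_short_zero[_eventually]_of_poly_piece` (any degree `d`, any
  `𝒞₀ ⊇ PolyShortPairs`), `dualCrossTablePsiOn_short_zero[_eventually]_of_poly_piece`, `tauTwoDarkShort[_eventually]_of_poly_piece`
  — the shapes of stmt-Parity-20429 / 20444 (`X₁ := 0`) / 20445 (`Y₁ := 0`) and of the kill path's `hX`/`hY` (stmt-Parity-20430)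
  ⇐ `∃ c₀, ∀ c′ ≥ c₀, InClassMeanPiece c′` (= `InClassSideTablesPiece`) + darkness of the cell on polynomial short pairs for
  all large `c′` (allowed to use the repaired K0 at the same `c′`; DISPLAY #3/#4 content, OPEN, existing vocabulary).

Typer: ls-knife-toeplitz-typer-1 g0 (literature-prover; PEN CLAIM STATUS 14:15:45Z).

## References
* Y. Zhang, arXiv:2211.02515v1 (2022), §2 Lemma 2.3, (2.15)–(2.17); §7 Prop. 7.1 (7.2) p. 13; §8 (8.5), Lemma 8.1,
  Lemma 8.2 p. 16, (8.23). [cite: Zhang2022LandauSiegel, §2 Lemma 2.3, §7 Prop 7.1 (7.2), §8 (8.5) Lemma 8.1 (8.23)]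
-/

noncomputable section

open Complex Real ComplexConjugate Finset

namespace Literature.NumberTheory.LFunctions.Zhang2022.KnifeEdge

open Repair Skeleton

/-! ### Part 1 — the density reductions over the UPPER side-table bound on in-class pieces only -/

section Upper

variable {c' : ℝ}

/-- **THE DENSITY REDUCTION (cross slot, every degree `d`, every pair class `𝒞`) OVER THE UPPER SIDE-TABLE BOUND ONLY.**
As `crossTablePsiOn_zero_of_dense` (p521442), with K0 replaced by exactly what its proof uses: for every in-class piece `w`
and `η > 0`, eventually under (A), `Ξ(H_w) ≤ (𝔅(w) + η)·𝔞𝔓` (hypothesis `hK0`; supplied by `InClassMean` via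
`discMean_profPoly_le_of_inClassMean`, by the repaired `InClassMeanPiece` via `discMean_profPoly_le_of_inClassMeanPiece`).
Proof verbatim from p521442. [cite: Zhang2022LandauSiegel, §2 Lemma 2.3, (2.15)–(2.17), §7 Prop 7.1, §8 (8.5), Lemma 8.1] -/
theorem crossTablePsiOn_zero_of_dense_upper {𝒞 𝒞₀ : PairClass} {d : ℕ}
    (hdark : CrossTablePsiOn c' 𝒞₀ d (fun _ _ _ _ => 0))
    (hK0 : ∀ (u u' : ℝ → ℂ), InClassPiece u u' → ∀ η : ℝ, 0 < η → ForAllLarge fun D _ χ => AssumptionA D χ →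
      discMean c' χ (fun x t => profPoly χ x u (⌊bigP D⌋₊ + 1) t) ≤ (mainTermForm u u' + η) * (frakA χ * frakP D))
    (h23 : Lemma23 c')
    (hdense : ∀ (f f' g g' : ℝ → ℂ), InClassPiece f f' → InClassPiece g g' → 𝒞 f f' g g' → ∀ η : ℝ, 0 < η →
      ∃ fN fN' gN gN' : ℝ → ℂ, InClassPiece fN fN' ∧ InClassPiece gN gN' ∧ 𝒞₀ fN fN' gN gN' ∧
        mainTermForm (fun x => f x - fN x) (fun x => f' x - fN' x) ≤ η ∧
        mainTermForm (fun x => g x - gN x) (fun x => g' x - gN' x) ≤ η) :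
    CrossTablePsiOn c' 𝒞 d (fun _ _ _ _ => 0) := by
  intro f f' g g' hf hg h𝒞 ε hε
  -- sizes of the two pieces in the 𝔅-currency
  set Bf := mainTermForm f f' with hBf
  set Bg := mainTermForm g g' with hBg
  have hBf0 : 0 ≤ Bf := mainTermForm_nonneg_of_isH1 hf.kinked.isH1
  have hBg0 : 0 ≤ Bg := mainTermForm_nonneg_of_isH1 hg.kinked.isH1
  set B := max Bf Bg with hB
  have hB0 : 0 ≤ B := le_max_of_le_left hBf0
  have hB1 : 0 < B + 1 := by linarith
  -- the approximation scale
  set η : ℝ := min 1 (min (ε / 16) (ε ^ 2 / (128 * (B + 1)))) with hη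
  have hη0 : 0 < η := lt_min zero_lt_one (lt_min (by positivity) (by positivity))
  have hη1 : η ≤ 1 := min_le_left _ _
  have hη16 : η ≤ ε / 16 := (min_le_right _ _).trans (min_le_left _ _)
  have hηsq : η ≤ ε ^ 2 / (128 * (B + 1)) := (min_le_right _ _).trans (min_le_right _ _)
  have h2η : η + η ≤ ε ^ 2 / (64 * (B + 1)) := by
    have : ε ^ 2 / (64 * (B + 1)) = 2 * (ε ^ 2 / (128 * (B + 1))) := by
      field_simp
      ring
    rw [this]
    linarith
  have hkey : ∀ {Bu : ℝ}, Bu ≤ B → (Bu + η) * (η + η) ≤ (ε / 8) ^ 2 := by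
    intro Bu hBu
    have h1 : Bu + η ≤ B + 1 := add_le_add hBu hη1
    calc (Bu + η) * (η + η) ≤ (B + 1) * (ε ^ 2 / (64 * (B + 1))) :=
          mul_le_mul h1 h2η (by positivity) (by positivity)
      _ = (ε / 8) ^ 2 := by
          field_simp
          ring
  -- the approximants and the differences
  obtain ⟨fN, fN', gN, gN', hfN, hgN, h𝒞₀, hBhf, hBhg⟩ := hdense f f' g g' hf hg h𝒞 η hη0
  have hhf : InClassPiece (fun x => f x - fN x) (fun x => f' x - fN' x) := hf.sub hfN
  have hhg : InClassPiece (fun x => g x - gN x) (fun x => g' x - gN' x) := hg.sub hgN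
  -- the eventual inputs
  have Edark := hdark fN fN' gN gN' hfN hgN h𝒞₀ (ε / 2) (by positivity)
  have Ef := hK0 _ _ hf _ hη0
  have Eg := hK0 _ _ hg _ hη0
  have Ehf := hK0 _ _ hhf _ hη0
  have Ehg := hK0 _ _ hhg _ hη0
  have E3 : ForAllLarge fun D _ _ => 3 ≤ D := ForAllLarge.of_le 3 fun D _ _ hD _ _ => hD
  refine ((((((Edark.and Ef).and Eg).and Ehf).and Ehg).and (h23.and prop22i_holds)).and E3).mono ?_
  intro D _ χ _ _ hh hA
  obtain ⟨⟨⟨⟨⟨⟨hdk, hKf⟩, hKg⟩, hKhf⟩, hKhg⟩, ⟨h23D, h22D⟩⟩, hD3⟩ := hh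
  -- weights and the unit on the index set
  have hw := weights_nonneg_of hD3 h23D h22D
  have hZ := norm_Zpsi_eq_one_of hD3 h22D
  -- abbreviations
  set N : ℕ := ⌊bigP D⌋₊ + 1 with hN
  set A : ℝ := frakA χ * frakP D with hA'
  have hA0 : 0 ≤ A := mul_nonneg (frakA_nonneg χ) (frakP_nonneg D)
  set Hf : Chr D → ℂ → ℂ := fun x t => profPoly χ x f N t with hHf
  set Hg : Chr D → ℂ → ℂ := fun x t => profPoly χ x g N t with hHg
  set Hhf : Chr D → ℂ → ℂ := fun x t => profPoly χ x (fun z => f z - fN z) N t with hHhf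
  set Hhg : Chr D → ℂ → ℂ := fun x t => profPoly χ x (fun z => g z - gN z) N t with hHhg
  set HfN : Chr D → ℂ → ℂ := fun x t => profPoly χ x fN N t with hHfN
  set HgN : Chr D → ℂ → ℂ := fun x t => profPoly χ x gN N t with hHgN
  -- the four K0 bounds
  have dmf : discMean c' χ Hf ≤ (Bf + η) * A := hKf hA
  have dmg : discMean c' χ Hg ≤ (Bg + η) * A := hKg hA
  have dmhf : discMean c' χ Hhf ≤ (η + η) * A :=
    (hKhf hA).trans (mul_le_mul_of_nonneg_right (by linarith) hA0)
  have dmhg : discMean c' χ Hhg ≤ (η + η) * A :=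
    (hKhg hA).trans (mul_le_mul_of_nonneg_right (by linarith) hA0)
  -- darkness of the approximant pair at ε/2
  have hdkN : ‖zDegMeanPsi c' χ d (fun x t => conj (HgN x t)) HfN‖ ≤ ε / 2 * A := by
    have h := hdk hA
    simp only [zero_mul, sub_zero] at h
    rw [hA', ← mul_assoc]
    exact h
  -- the sesquilinear decomposition Φ(g,f) = Φ(gN,fN) + Φ(g,hf) + Φ(hg,f) − Φ(hg,hf)
  have e1 : HfN = fun x t => Hf x t - Hhf x t := by
    funext x t
    simp only [hHf, hHhf, hHfN, profPoly_sub]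
    ring
  have e2 : (fun x t => conj (HgN x t)) = fun x t => conj (Hg x t) - conj (Hhg x t) := by
    funext x t
    simp only [hHg, hHhg, hHgN, profPoly_sub, map_sub]
    ring
  have hdecomp : zDegMeanPsi c' χ d (fun x t => conj (Hg x t)) Hf =
      zDegMeanPsi c' χ d (fun x t => conj (HgN x t)) HfN + zDegMeanPsi c' χ d (fun x t => conj (Hg x t)) Hhf +
        zDegMeanPsi c' χ d (fun x t => conj (Hhg x t)) Hf - zDegMeanPsi c' χ d (fun x t => conj (Hhg x t)) Hhf := by
    rw [e2, e1, zDegMeanPsi_sub_left, zDegMeanPsi_sub_right, zDegMeanPsi_sub_right]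
    ring
  -- Cauchy–Schwarz on the three corrections
  have c1 : ‖zDegMeanPsi c' χ d (fun x t => conj (Hg x t)) Hhf‖ ≤ Real.sqrt ((Bg + η) * A * ((η + η) * A)) := by
    refine (norm_zDegMeanPsi_le_sqrt hw hZ _ _ _).trans (Real.sqrt_le_sqrt ?_)
    rw [discMean_conj]
    exact mul_le_mul dmg dmhf (discMean_nonneg hw _) (by positivity)
  have c2 : ‖zDegMeanPsi c' χ d (fun x t => conj (Hhg x t)) Hf‖ ≤ Real.sqrt ((η + η) * A * ((Bf + η) * A)) := by
    refine (norm_zDegMeanPsi_le_sqrt hw hZ _ _ _).trans (Real.sqrt_le_sqrt ?_)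
    rw [discMean_conj]
    exact mul_le_mul dmhg dmf (discMean_nonneg hw _) (by positivity)
  have c3 : ‖zDegMeanPsi c' χ d (fun x t => conj (Hhg x t)) Hhf‖ ≤ Real.sqrt ((η + η) * A * ((η + η) * A)) := by
    refine (norm_zDegMeanPsi_le_sqrt hw hZ _ _ _).trans (Real.sqrt_le_sqrt ?_)
    rw [discMean_conj]
    exact mul_le_mul dmhg dmhf (discMean_nonneg hw _) (by positivity)
  -- evaluate the square roots with the choice of η
  have s1 : Real.sqrt ((Bg + η) * A * ((η + η) * A)) ≤ ε / 8 * A := by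
    have hle : (Bg + η) * A * ((η + η) * A) ≤ (ε / 8 * A) ^ 2 := by
      calc (Bg + η) * A * ((η + η) * A) = ((Bg + η) * (η + η)) * A ^ 2 := by ring
        _ ≤ (ε / 8) ^ 2 * A ^ 2 := mul_le_mul_of_nonneg_right (hkey (le_max_right _ _)) (sq_nonneg A)
        _ = (ε / 8 * A) ^ 2 := by ring
    calc Real.sqrt ((Bg + η) * A * ((η + η) * A)) ≤ Real.sqrt ((ε / 8 * A) ^ 2) := Real.sqrt_le_sqrt hle
      _ = ε / 8 * A := Real.sqrt_sq (by positivity)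
  have s2 : Real.sqrt ((η + η) * A * ((Bf + η) * A)) ≤ ε / 8 * A := by
    have hle : (η + η) * A * ((Bf + η) * A) ≤ (ε / 8 * A) ^ 2 := by
      calc (η + η) * A * ((Bf + η) * A) = ((Bf + η) * (η + η)) * A ^ 2 := by ring
        _ ≤ (ε / 8) ^ 2 * A ^ 2 := mul_le_mul_of_nonneg_right (hkey (le_max_left _ _)) (sq_nonneg A)
        _ = (ε / 8 * A) ^ 2 := by ring
    calc Real.sqrt ((η + η) * A * ((Bf + η) * A)) ≤ Real.sqrt ((ε / 8 * A) ^ 2) := Real.sqrt_le_sqrt hle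
      _ = ε / 8 * A := Real.sqrt_sq (by positivity)
  have s3 : Real.sqrt ((η + η) * A * ((η + η) * A)) ≤ ε / 8 * A := by
    rw [show (η + η) * A * ((η + η) * A) = ((η + η) * A) ^ 2 by ring,
      Real.sqrt_sq (by positivity)]
    exact mul_le_mul_of_nonneg_right (by linarith) hA0
  -- assemble
  have hgoal : ‖zDegMeanPsi c' χ d (fun x t => conj (Hg x t)) Hf‖ ≤ ε * A := by
    rw [hdecomp]
    calc ‖zDegMeanPsi c' χ d (fun x t => conj (HgN x t)) HfN + zDegMeanPsi c' χ d (fun x t => conj (Hg x t)) Hhf +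
            zDegMeanPsi c' χ d (fun x t => conj (Hhg x t)) Hf - zDegMeanPsi c' χ d (fun x t => conj (Hhg x t)) Hhf‖
        ≤ ‖zDegMeanPsi c' χ d (fun x t => conj (HgN x t)) HfN‖ + ‖zDegMeanPsi c' χ d (fun x t => conj (Hg x t)) Hhf‖ +
            ‖zDegMeanPsi c' χ d (fun x t => conj (Hhg x t)) Hf‖ + ‖zDegMeanPsi c' χ d (fun x t => conj (Hhg x t)) Hhf‖ :=
          (norm_sub_le _ _).trans (by gcongr; exact (norm_add_le _ _).trans (by gcongr; exact norm_add_le _ _))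
      _ ≤ ε / 2 * A + ε / 8 * A + ε / 8 * A + ε / 8 * A :=
          add_le_add (add_le_add (add_le_add hdkN (c1.trans s1)) (c2.trans s2)) (c3.trans s3)
      _ ≤ ε * A := by nlinarith [hA0, hε.le]
  simpa only [zero_mul, sub_zero, hA', mul_assoc] using hgoal

/-- **THE DENSITY REDUCTION (dual slot) OVER THE UPPER SIDE-TABLE BOUND ONLY** — as `dualCrossTablePsiOn_zero_of_dense`
(p528742) with K0 replaced by the upper bound on in-class pieces; proof verbatim from p528742.
[cite: Zhang2022LandauSiegel, §2 Lemma 2.3, (2.15)–(2.17), §7 Prop 7.1, §8 (8.5), Lemma 8.1] -/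
theorem dualCrossTablePsiOn_zero_of_dense_upper {𝒞 𝒞₀ : PairClass} {d : ℕ}
    (hdark : DualCrossTablePsiOn c' 𝒞₀ d (fun _ _ _ _ => 0))
    (hK0 : ∀ (u u' : ℝ → ℂ), InClassPiece u u' → ∀ η : ℝ, 0 < η → ForAllLarge fun D _ χ => AssumptionA D χ →
      discMean c' χ (fun x t => profPoly χ x u (⌊bigP D⌋₊ + 1) t) ≤ (mainTermForm u u' + η) * (frakA χ * frakP D))
    (h23 : Lemma23 c')
    (hdense : ∀ (g₁ g₁' g₂ g₂' : ℝ → ℂ), InClassPiece g₁ g₁' → InClassPiece g₂ g₂' → 𝒞 g₁ g₁' g₂ g₂' →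
      ∀ η : ℝ, 0 < η →
      ∃ g₁N g₁N' g₂N g₂N' : ℝ → ℂ, InClassPiece g₁N g₁N' ∧ InClassPiece g₂N g₂N' ∧ 𝒞₀ g₁N g₁N' g₂N g₂N' ∧
        mainTermForm (fun x => g₁ x - g₁N x) (fun x => g₁' x - g₁N' x) ≤ η ∧
        mainTermForm (fun x => g₂ x - g₂N x) (fun x => g₂' x - g₂N' x) ≤ η) :
    DualCrossTablePsiOn c' 𝒞 d (fun _ _ _ _ => 0) := by
  intro g₁ g₁' g₂ g₂' hg₁ hg₂ h𝒞 ε hε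
  -- sizes of the two pieces in the 𝔅-currency
  set B1 := mainTermForm g₁ g₁' with hB1
  set B2 := mainTermForm g₂ g₂' with hB2
  have hB10 : 0 ≤ B1 := mainTermForm_nonneg_of_isH1 hg₁.kinked.isH1
  have hB20 : 0 ≤ B2 := mainTermForm_nonneg_of_isH1 hg₂.kinked.isH1
  set B := max B1 B2 with hB
  have hB0 : 0 ≤ B := le_max_of_le_left hB10
  have hBp : 0 < B + 1 := by linarith
  -- the approximation scale
  set η : ℝ := min 1 (min (ε / 16) (ε ^ 2 / (128 * (B + 1)))) with hη
  have hη0 : 0 < η := lt_min zero_lt_one (lt_min (by positivity) (by positivity))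
  have hη1 : η ≤ 1 := min_le_left _ _
  have hη16 : η ≤ ε / 16 := (min_le_right _ _).trans (min_le_left _ _)
  have hηsq : η ≤ ε ^ 2 / (128 * (B + 1)) := (min_le_right _ _).trans (min_le_right _ _)
  have h2η : η + η ≤ ε ^ 2 / (64 * (B + 1)) := by
    have : ε ^ 2 / (64 * (B + 1)) = 2 * (ε ^ 2 / (128 * (B + 1))) := by
      field_simp
      ring
    rw [this]
    linarith
  have hkey : ∀ {Bu : ℝ}, Bu ≤ B → (Bu + η) * (η + η) ≤ (ε / 8) ^ 2 := by
    intro Bu hBu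
    have h1 : Bu + η ≤ B + 1 := add_le_add hBu hη1
    calc (Bu + η) * (η + η) ≤ (B + 1) * (ε ^ 2 / (64 * (B + 1))) :=
          mul_le_mul h1 h2η (by positivity) (by positivity)
      _ = (ε / 8) ^ 2 := by
          field_simp
          ring
  -- the approximants and the differences
  obtain ⟨g₁N, g₁N', g₂N, g₂N', hg₁N, hg₂N, h𝒞₀, hBh1, hBh2⟩ := hdense g₁ g₁' g₂ g₂' hg₁ hg₂ h𝒞 η hη0
  have hh1 : InClassPiece (fun x => g₁ x - g₁N x) (fun x => g₁' x - g₁N' x) := hg₁.sub hg₁N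
  have hh2 : InClassPiece (fun x => g₂ x - g₂N x) (fun x => g₂' x - g₂N' x) := hg₂.sub hg₂N
  -- the eventual inputs
  have Edark := hdark g₁N g₁N' g₂N g₂N' hg₁N hg₂N h𝒞₀ (ε / 2) (by positivity)
  have E1 := hK0 _ _ hg₁ _ hη0
  have E2 := hK0 _ _ hg₂ _ hη0
  have Eh1 := hK0 _ _ hh1 _ hη0
  have Eh2 := hK0 _ _ hh2 _ hη0
  have E3 : ForAllLarge fun D _ _ => 3 ≤ D := ForAllLarge.of_le 3 fun D _ _ hD _ _ => hD
  refine ((((((Edark.and E1).and E2).and Eh1).and Eh2).and (h23.and prop22i_holds)).and E3).mono ?_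
  intro D _ χ _ _ hh hA
  obtain ⟨⟨⟨⟨⟨⟨hdk, hK1⟩, hK2⟩, hKh1⟩, hKh2⟩, ⟨h23D, h22D⟩⟩, hD3⟩ := hh
  -- weights and the unit on the index set
  have hw := weights_nonneg_of hD3 h23D h22D
  have hZ := norm_Zpsi_eq_one_of hD3 h22D
  -- abbreviations
  set N : ℕ := ⌊bigP D⌋₊ + 1 with hN
  set A : ℝ := frakA χ * frakP D with hA'
  have hA0 : 0 ≤ A := mul_nonneg (frakA_nonneg χ) (frakP_nonneg D)
  set H1 : Chr D → ℂ → ℂ := fun x t => profPoly χ x g₁ N t with hH1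
  set H2 : Chr D → ℂ → ℂ := fun x t => profPoly χ x g₂ N t with hH2
  set Hh1 : Chr D → ℂ → ℂ := fun x t => profPoly χ x (fun z => g₁ z - g₁N z) N t with hHh1
  set Hh2 : Chr D → ℂ → ℂ := fun x t => profPoly χ x (fun z => g₂ z - g₂N z) N t with hHh2
  set H1N : Chr D → ℂ → ℂ := fun x t => profPoly χ x g₁N N t with hH1N
  set H2N : Chr D → ℂ → ℂ := fun x t => profPoly χ x g₂N N t with hH2N
  -- the four K0 bounds
  have dm1 : discMean c' χ H1 ≤ (B1 + η) * A := hK1 hA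
  have dm2 : discMean c' χ H2 ≤ (B2 + η) * A := hK2 hA
  have dmh1 : discMean c' χ Hh1 ≤ (η + η) * A :=
    (hKh1 hA).trans (mul_le_mul_of_nonneg_right (by linarith) hA0)
  have dmh2 : discMean c' χ Hh2 ≤ (η + η) * A :=
    (hKh2 hA).trans (mul_le_mul_of_nonneg_right (by linarith) hA0)
  -- darkness of the approximant pair at ε/2
  have hdkN : ‖zDegMeanPsi c' χ d (fun x t => conj (H2N x t)) (fun x t => conj (H1N x t))‖ ≤ ε / 2 * A := by
    have h := hdk hA
    simp only [zero_mul, sub_zero] at h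
    rw [hA', ← mul_assoc]
    exact h
  -- the sesquilinear decomposition
  have e1 : (fun x t => conj (H1N x t)) = fun x t => conj (H1 x t) - conj (Hh1 x t) := by
    funext x t
    simp only [hH1, hHh1, hH1N, profPoly_sub, map_sub]
    ring
  have e2 : (fun x t => conj (H2N x t)) = fun x t => conj (H2 x t) - conj (Hh2 x t) := by
    funext x t
    simp only [hH2, hHh2, hH2N, profPoly_sub, map_sub]
    ring
  have hdecomp : zDegMeanPsi c' χ d (fun x t => conj (H2 x t)) (fun x t => conj (H1 x t)) =
      zDegMeanPsi c' χ d (fun x t => conj (H2N x t)) (fun x t => conj (H1N x t)) +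
        zDegMeanPsi c' χ d (fun x t => conj (H2 x t)) (fun x t => conj (Hh1 x t)) +
        zDegMeanPsi c' χ d (fun x t => conj (Hh2 x t)) (fun x t => conj (H1 x t)) -
        zDegMeanPsi c' χ d (fun x t => conj (Hh2 x t)) (fun x t => conj (Hh1 x t)) := by
    rw [e2, e1, zDegMeanPsi_sub_left, zDegMeanPsi_sub_right, zDegMeanPsi_sub_right]
    ring
  -- Cauchy–Schwarz on the three corrections
  have c1 : ‖zDegMeanPsi c' χ d (fun x t => conj (H2 x t)) (fun x t => conj (Hh1 x t))‖ ≤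
      Real.sqrt ((B2 + η) * A * ((η + η) * A)) := by
    refine (norm_zDegMeanPsi_le_sqrt hw hZ _ _ _).trans (Real.sqrt_le_sqrt ?_)
    rw [discMean_conj, discMean_conj]
    exact mul_le_mul dm2 dmh1 (discMean_nonneg hw _) (by positivity)
  have c2 : ‖zDegMeanPsi c' χ d (fun x t => conj (Hh2 x t)) (fun x t => conj (H1 x t))‖ ≤
      Real.sqrt ((η + η) * A * ((B1 + η) * A)) := by
    refine (norm_zDegMeanPsi_le_sqrt hw hZ _ _ _).trans (Real.sqrt_le_sqrt ?_)
    rw [discMean_conj, discMean_conj]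
    exact mul_le_mul dmh2 dm1 (discMean_nonneg hw _) (by positivity)
  have c3 : ‖zDegMeanPsi c' χ d (fun x t => conj (Hh2 x t)) (fun x t => conj (Hh1 x t))‖ ≤
      Real.sqrt ((η + η) * A * ((η + η) * A)) := by
    refine (norm_zDegMeanPsi_le_sqrt hw hZ _ _ _).trans (Real.sqrt_le_sqrt ?_)
    rw [discMean_conj, discMean_conj]
    exact mul_le_mul dmh2 dmh1 (discMean_nonneg hw _) (by positivity)
  -- evaluate the square roots with the choice of η
  have s1 : Real.sqrt ((B2 + η) * A * ((η + η) * A)) ≤ ε / 8 * A := by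
    have hle : (B2 + η) * A * ((η + η) * A) ≤ (ε / 8 * A) ^ 2 := by
      calc (B2 + η) * A * ((η + η) * A) = ((B2 + η) * (η + η)) * A ^ 2 := by ring
        _ ≤ (ε / 8) ^ 2 * A ^ 2 := mul_le_mul_of_nonneg_right (hkey (le_max_right _ _)) (sq_nonneg A)
        _ = (ε / 8 * A) ^ 2 := by ring
    calc Real.sqrt ((B2 + η) * A * ((η + η) * A)) ≤ Real.sqrt ((ε / 8 * A) ^ 2) := Real.sqrt_le_sqrt hle
      _ = ε / 8 * A := Real.sqrt_sq (by positivity)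
  have s2 : Real.sqrt ((η + η) * A * ((B1 + η) * A)) ≤ ε / 8 * A := by
    have hle : (η + η) * A * ((B1 + η) * A) ≤ (ε / 8 * A) ^ 2 := by
      calc (η + η) * A * ((B1 + η) * A) = ((B1 + η) * (η + η)) * A ^ 2 := by ring
        _ ≤ (ε / 8) ^ 2 * A ^ 2 := mul_le_mul_of_nonneg_right (hkey (le_max_left _ _)) (sq_nonneg A)
        _ = (ε / 8 * A) ^ 2 := by ring
    calc Real.sqrt ((η + η) * A * ((B1 + η) * A)) ≤ Real.sqrt ((ε / 8 * A) ^ 2) := Real.sqrt_le_sqrt hle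
      _ = ε / 8 * A := Real.sqrt_sq (by positivity)
  have s3 : Real.sqrt ((η + η) * A * ((η + η) * A)) ≤ ε / 8 * A := by
    rw [show (η + η) * A * ((η + η) * A) = ((η + η) * A) ^ 2 by ring,
      Real.sqrt_sq (by positivity)]
    exact mul_le_mul_of_nonneg_right (by linarith) hA0
  -- assemble
  have hgoal : ‖zDegMeanPsi c' χ d (fun x t => conj (H2 x t)) (fun x t => conj (H1 x t))‖ ≤ ε * A := by
    rw [hdecomp]
    calc ‖zDegMeanPsi c' χ d (fun x t => conj (H2N x t)) (fun x t => conj (H1N x t)) +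
            zDegMeanPsi c' χ d (fun x t => conj (H2 x t)) (fun x t => conj (Hh1 x t)) +
            zDegMeanPsi c' χ d (fun x t => conj (Hh2 x t)) (fun x t => conj (H1 x t)) -
            zDegMeanPsi c' χ d (fun x t => conj (Hh2 x t)) (fun x t => conj (Hh1 x t))‖
        ≤ ‖zDegMeanPsi c' χ d (fun x t => conj (H2N x t)) (fun x t => conj (H1N x t))‖ +
            ‖zDegMeanPsi c' χ d (fun x t => conj (H2 x t)) (fun x t => conj (Hh1 x t))‖ +
            ‖zDegMeanPsi c' χ d (fun x t => conj (Hh2 x t)) (fun x t => conj (H1 x t))‖ +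
            ‖zDegMeanPsi c' χ d (fun x t => conj (Hh2 x t)) (fun x t => conj (Hh1 x t))‖ :=
          (norm_sub_le _ _).trans (by gcongr; exact (norm_add_le _ _).trans (by gcongr; exact norm_add_le _ _))
      _ ≤ ε / 2 * A + ε / 8 * A + ε / 8 * A + ε / 8 * A :=
          add_le_add (add_le_add (add_le_add hdkN (c1.trans s1)) (c2.trans s2)) (c3.trans s3)
      _ ≤ ε * A := by nlinarith [hA0, hε.le]
  simpa only [zero_mul, sub_zero, hA', mul_assoc] using hgoal

end Upper

/-! ### Part 2 — the `_piece` twins of the density reductions (repaired K0 `InClassMeanPiece`) -/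

section Piece

variable {c' : ℝ}

/-- The cross-slot density reduction over the REPAIRED side tables `InClassMeanPiece c′` (binder `InClassPiece`).
[cite: Zhang2022LandauSiegel, §2 Lemma 2.3, §7 Prop 7.1, §8 (8.5) Lemma 8.1 (8.23)] -/
theorem crossTablePsiOn_zero_of_dense_piece {𝒞 𝒞₀ : PairClass} {d : ℕ}
    (hdark : CrossTablePsiOn c' 𝒞₀ d (fun _ _ _ _ => 0)) (hK0 : InClassMeanPiece c') (h23 : Lemma23 c')
    (hdense : ∀ (f f' g g' : ℝ → ℂ), InClassPiece f f' → InClassPiece g g' → 𝒞 f f' g g' → ∀ η : ℝ, 0 < η →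
      ∃ fN fN' gN gN' : ℝ → ℂ, InClassPiece fN fN' ∧ InClassPiece gN gN' ∧ 𝒞₀ fN fN' gN gN' ∧
        mainTermForm (fun x => f x - fN x) (fun x => f' x - fN' x) ≤ η ∧
        mainTermForm (fun x => g x - gN x) (fun x => g' x - gN' x) ≤ η) :
    CrossTablePsiOn c' 𝒞 d (fun _ _ _ _ => 0) :=
  crossTablePsiOn_zero_of_dense_upper hdark (fun _ _ hu _ hη => discMean_profPoly_le_of_inClassMeanPiece hK0 hu hη)
    h23 hdense

/-- The dual-slot density reduction over the REPAIRED side tables `InClassMeanPiece c′`.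
[cite: Zhang2022LandauSiegel, §2 (2.17) Lemma 2.3, §7 Prop 7.1, §8 (8.5) Lemma 8.1 (8.23)] -/
theorem dualCrossTablePsiOn_zero_of_dense_piece {𝒞 𝒞₀ : PairClass} {d : ℕ}
    (hdark : DualCrossTablePsiOn c' 𝒞₀ d (fun _ _ _ _ => 0)) (hK0 : InClassMeanPiece c') (h23 : Lemma23 c')
    (hdense : ∀ (g₁ g₁' g₂ g₂' : ℝ → ℂ), InClassPiece g₁ g₁' → InClassPiece g₂ g₂' → 𝒞 g₁ g₁' g₂ g₂' →
      ∀ η : ℝ, 0 < η →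
      ∃ g₁N g₁N' g₂N g₂N' : ℝ → ℂ, InClassPiece g₁N g₁N' ∧ InClassPiece g₂N g₂N' ∧ 𝒞₀ g₁N g₁N' g₂N g₂N' ∧
        mainTermForm (fun x => g₁ x - g₁N x) (fun x => g₁' x - g₁N' x) ≤ η ∧
        mainTermForm (fun x => g₂ x - g₂N x) (fun x => g₂' x - g₂N' x) ≤ η) :
    DualCrossTablePsiOn c' 𝒞 d (fun _ _ _ _ => 0) :=
  dualCrossTablePsiOn_zero_of_dense_upper hdark (fun _ _ hu _ hη => discMean_profPoly_le_of_inClassMeanPiece hK0 hu hη)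
    h23 hdense

/-- `tauTwoDarkShort_of_dense` over the repaired side tables: darkness on `𝒞₀` + `InClassMeanPiece c′` + Lemma 2.3 +
`𝔅`-approximation of the short pairs by `𝒞₀` ⇒ `TauTwoDarkShort c′`. [cite: Zhang2022LandauSiegel, §2 Lemma 2.3, §8 (8.5) Lemma 8.1 Lemma 8.2] -/
theorem tauTwoDarkShort_of_dense_piece {𝒞₀ : PairClass}
    (hdark : CrossTablePsiOn c' 𝒞₀ 2 (fun _ _ _ _ => 0)) (hK0 : InClassMeanPiece c') (h23 : Lemma23 c')
    (hdense : ∀ (f f' g g' : ℝ → ℂ), InClassPiece f f' → InClassPiece g g' → ShortPairs f f' g g' → ∀ η : ℝ, 0 < η →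
      ∃ fN fN' gN gN' : ℝ → ℂ, InClassPiece fN fN' ∧ InClassPiece gN gN' ∧ 𝒞₀ fN fN' gN gN' ∧
        mainTermForm (fun x => f x - fN x) (fun x => f' x - fN' x) ≤ η ∧
        mainTermForm (fun x => g x - gN x) (fun x => g' x - gN' x) ≤ η) :
    TauTwoDarkShort c' :=
  crossTablePsiOn_zero_of_dense_piece hdark hK0 h23 hdense

/-- … and for all large `c′` with Lemma 2.3 discharged (`lemma23_eventually`). [cite: Zhang2022LandauSiegel, §2 Lemma 2.3, §8 (8.5)] -/
theorem tauTwoDarkShort_of_dense_piece_eventually :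
    ∃ c₀ : ℝ, 0 ≤ c₀ ∧ ∀ c' : ℝ, c₀ ≤ c' → ∀ {𝒞₀ : PairClass},
      CrossTablePsiOn c' 𝒞₀ 2 (fun _ _ _ _ => 0) → InClassMeanPiece c' →
      (∀ (f f' g g' : ℝ → ℂ), InClassPiece f f' → InClassPiece g g' → ShortPairs f f' g g' → ∀ η : ℝ, 0 < η →
        ∃ fN fN' gN gN' : ℝ → ℂ, InClassPiece fN fN' ∧ InClassPiece gN gN' ∧ 𝒞₀ fN fN' gN gN' ∧
          mainTermForm (fun x => f x - fN x) (fun x => f' x - fN' x) ≤ η ∧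
          mainTermForm (fun x => g x - gN x) (fun x => g' x - gN' x) ≤ η) →
      TauTwoDarkShort c' := by
  obtain ⟨c₀, h0, h⟩ := lemma23_eventually
  exact ⟨c₀, h0, fun c' hc' _ hdark hK0 hdense => tauTwoDarkShort_of_dense_piece hdark hK0 (h c' hc') hdense⟩

end Piece

/-! ### Part 3 — the `_piece` twins of the darkness PORTS (K0 := the repaired `InClassSideTablesPiece`) -/

section PortsPiece

variable {c' : ℝ} {𝒞₀ : PairClass}

/-- **PORT (cross cell, any degree), repaired K0:** dark on `𝒞₀ ⊇ PolyShortPairs` + `InClassMeanPiece c′` + Lemma 2.3 ⇒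
`CrossTablePsiOn c′ ShortPairs d 0`. [cite: Zhang2022LandauSiegel, §2 Lemma 2.3, §7 Prop 7.1 (7.2), §8 (8.5) Lemma 8.1 Lemma 8.2 p.16] -/
theorem crossTablePsiOn_short_zero_of_poly_piece {d : ℕ} (h𝒞₀ : ∀ f f' g g', PolyShortPairs f f' g g' → 𝒞₀ f f' g g')
    (hdark : CrossTablePsiOn c' 𝒞₀ d (fun _ _ _ _ => 0)) (hK0 : InClassMeanPiece c') (h23 : Lemma23 c') :
    CrossTablePsiOn c' ShortPairs d (fun _ _ _ _ => 0) :=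
  crossTablePsiOn_zero_of_dense_piece hdark hK0 h23 (shortPairs_dense_of_poly h𝒞₀)

/-- **PORT (dual cell, any degree), repaired K0.** [cite: Zhang2022LandauSiegel, §2 (2.17) Lemma 2.3, §8 (8.5) Lemma 8.1 p.16] -/
theorem dualCrossTablePsiOn_short_zero_of_poly_piece {d : ℕ}
    (h𝒞₀ : ∀ f f' g g', PolyShortPairs f f' g g' → 𝒞₀ f f' g g')
    (hdark : DualCrossTablePsiOn c' 𝒞₀ d (fun _ _ _ _ => 0)) (hK0 : InClassMeanPiece c') (h23 : Lemma23 c') :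
    DualCrossTablePsiOn c' ShortPairs d (fun _ _ _ _ => 0) :=
  dualCrossTablePsiOn_zero_of_dense_piece hdark hK0 h23 (shortPairs_dense_of_poly h𝒞₀)

/-- **PORT (degree-2 cell), repaired K0:** `TauTwoDarkShort c′`. [cite: Zhang2022LandauSiegel, §2 Lemma 2.3, §4 Lemma 4.8 p.9, §8 (8.5) Lemma 8.1 Lemma 8.2 p.16] -/
theorem tauTwoDarkShort_of_poly_piece (h𝒞₀ : ∀ f f' g g', PolyShortPairs f f' g g' → 𝒞₀ f f' g g')
    (hdark : CrossTablePsiOn c' 𝒞₀ 2 (fun _ _ _ _ => 0)) (hK0 : InClassMeanPiece c') (h23 : Lemma23 c') :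
    TauTwoDarkShort c' :=
  crossTablePsiOn_short_zero_of_poly_piece h𝒞₀ hdark hK0 h23

/-- **PORT, eventually in `c′` (cross cell, any degree), repaired K0** = `InClassSideTablesPiece` (`∃ c₀, ∀ c′ ≥ c₀,
InClassMeanPiece c′`) + darkness on `𝒞₀ ⊇ PolyShortPairs` for all large `c′` (allowed to use the repaired K0 at `c′`) ⇒
`∃ c₀, ∀ c′ ≥ c₀, CrossTablePsiOn c′ ShortPairs d 0` — `d = 1`: the kill path's `hX` and stmt-Parity-20444 with `X₁ := 0`.
[cite: Zhang2022LandauSiegel, §2 Lemma 2.3, §8 (8.5) Lemma 8.1 p.16] -/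
theorem crossTablePsiOn_short_zero_eventually_of_poly_piece {d : ℕ}
    (h𝒞₀ : ∀ f f' g g', PolyShortPairs f f' g g' → 𝒞₀ f f' g g')
    (hK0 : ∃ c₀ : ℝ, ∀ c' : ℝ, c₀ ≤ c' → InClassMeanPiece c')
    (hdark : ∃ c₀ : ℝ, ∀ c' : ℝ, c₀ ≤ c' → InClassMeanPiece c' → CrossTablePsiOn c' 𝒞₀ d (fun _ _ _ _ => 0)) :
    ∃ c₀ : ℝ, ∀ c' : ℝ, c₀ ≤ c' → CrossTablePsiOn c' ShortPairs d (fun _ _ _ _ => 0) := by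
  obtain ⟨c₁, h₁⟩ := hK0
  obtain ⟨c₂, h₂⟩ := hdark
  obtain ⟨c₃, -, h₃⟩ := lemma23_eventually
  refine ⟨max (max c₁ c₂) c₃, fun c' hc' => ?_⟩
  have hc1 : c₁ ≤ c' := le_trans (le_trans (le_max_left _ _) (le_max_left _ _)) hc'
  have hc2 : c₂ ≤ c' := le_trans (le_trans (le_max_right _ _) (le_max_left _ _)) hc'
  have hc3 : c₃ ≤ c' := le_trans (le_max_right _ _) hc'
  exact crossTablePsiOn_short_zero_of_poly_piece h𝒞₀ (h₂ c' hc2 (h₁ c' hc1)) (h₁ c' hc1) (h₃ c' hc3)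

/-- **PORT, eventually in `c′` (dual cell, any degree), repaired K0** — `d = 1`: the kill path's `hY` and stmt-Parity-20445
with `Y₁ := 0`. [cite: Zhang2022LandauSiegel, §2 (2.17) Lemma 2.3, §8 (8.5) Lemma 8.1 p.16] -/
theorem dualCrossTablePsiOn_short_zero_eventually_of_poly_piece {d : ℕ}
    (h𝒞₀ : ∀ f f' g g', PolyShortPairs f f' g g' → 𝒞₀ f f' g g')
    (hK0 : ∃ c₀ : ℝ, ∀ c' : ℝ, c₀ ≤ c' → InClassMeanPiece c')
    (hdark : ∃ c₀ : ℝ, ∀ c' : ℝ, c₀ ≤ c' → InClassMeanPiece c' → DualCrossTablePsiOn c' 𝒞₀ d (fun _ _ _ _ => 0)) :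
    ∃ c₀ : ℝ, ∀ c' : ℝ, c₀ ≤ c' → DualCrossTablePsiOn c' ShortPairs d (fun _ _ _ _ => 0) := by
  obtain ⟨c₁, h₁⟩ := hK0
  obtain ⟨c₂, h₂⟩ := hdark
  obtain ⟨c₃, -, h₃⟩ := lemma23_eventually
  refine ⟨max (max c₁ c₂) c₃, fun c' hc' => ?_⟩
  have hc1 : c₁ ≤ c' := le_trans (le_trans (le_max_left _ _) (le_max_left _ _)) hc'
  have hc2 : c₂ ≤ c' := le_trans (le_trans (le_max_right _ _) (le_max_left _ _)) hc'
  have hc3 : c₃ ≤ c' := le_trans (le_max_right _ _) hc'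
  exact dualCrossTablePsiOn_short_zero_of_poly_piece h𝒞₀ (h₂ c' hc2 (h₁ c' hc1)) (h₁ c' hc1) (h₃ c' hc3)

/-- **PORT, eventually in `c′` (degree-2 cell), repaired K0** — the shape of stmt-Parity-20429 `ShortPairsTauTwoDark` ⇐
`InClassSideTablesPiece` + x₂-darkness on `𝒞₀ ⊇ PolyShortPairs`. [cite: Zhang2022LandauSiegel, §2 Lemma 2.3, §4 Lemma 4.8 p.9, §8 (8.5) Lemma 8.1 Lemma 8.2 p.16] -/
theorem tauTwoDarkShort_eventually_of_poly_piece
    (h𝒞₀ : ∀ f f' g g', PolyShortPairs f f' g g' → 𝒞₀ f f' g g')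
    (hK0 : ∃ c₀ : ℝ, ∀ c' : ℝ, c₀ ≤ c' → InClassMeanPiece c')
    (hdark : ∃ c₀ : ℝ, ∀ c' : ℝ, c₀ ≤ c' → InClassMeanPiece c' → CrossTablePsiOn c' 𝒞₀ 2 (fun _ _ _ _ => 0)) :
    ∃ c₀ : ℝ, ∀ c' : ℝ, c₀ ≤ c' → TauTwoDarkShort c' :=
  crossTablePsiOn_short_zero_eventually_of_poly_piece h𝒞₀ hK0 hdark

end PortsPiece

end Literature.NumberTheory.LFunctions.Zhang2022.KnifeEdge

end
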